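import Summits.HodgeConjecture.HodgeConjecture.Theses.SparseFermatTropicalDeficiency
import Literature.AlgebraicGeometry.HodgeTheory.WeilClassesCyclicPrymDimension

/-!
# `InvariantClassesAreHodge` is false modulo the cohomology of one degenerate member (negative lemma)

Crux `stmt-HodgeConjecture-18620` = `SparseFermatTropicalDeficiency.InvariantClassesAreHodge` (route
`route-HodgeConjecture-SparseFermatTropicalDeficiency`, rank 4): for every PURE sparse Fermat datum
`𝔇 = (p, d, B)` and EVERY `c` with `X_c = 𝔇.variety c` smooth projective of dimension `2p` there are
`m(𝔇) = 𝔇.invariantRank` rational, `(p,p)`, `π`-fixed classes `e_i` such that every family `x` whose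
invariant projections span a space containing the `e_i` has `cupRank ≥ m(𝔇)`.

**The junk member.** `𝔇.variety c = SmoothHypersurface.hypersurface (𝔇.form c)` carries the REDUCED
INDUCED structure on the zero locus `V₊(form c)` (it depends on the form only through its zero set), so
a member whose form is a perfect power `gᵏ` of a NONSINGULAR form `g` is the smooth hypersurface `V₊(g)`
of degree `d/k`: it satisfies the hypothesis `IsSmoothProjective (2p) (𝔇.variety c)` although `c` lies
OUTSIDE the smooth locus of the degree-`d` family, and Shioda's invariant count (valid on that connected
locus, which contains the Fermat member `c = 0`) need not hold there. Concretely, for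
`𝔇₀ = (p, d, B₀) = (2, 4, {2eᵢ + 2eⱼ : i < j})` (`quadricDatum`) and `c₀ ≡ 2` (`cTwo`):
`form c₀ = Σ xᵢ⁴ + 2 Σ_{i<j} xᵢ² xⱼ² = (Σᵢ xᵢ²)²`, so `X_{c₀}` is the smooth quadric fourfold
`Q ⊂ ℙ⁵`. Its symmetry group `A_{B₀} = {ζ ∈ μ₄⁶ : ζᵢ² = ζⱼ² ∀ i, j}` contains the reflection
`σ = (-1, 1, 1, 1, 1, 1)`, which interchanges the two rulings `Λ, Λ'` of `Q` (in coordinates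
`Q = {y₁y₂ + y₃y₄ + y₅y₆ = 0}`, `y₁ = x₁ + ix₂ ↔ y₂ = x₁ - ix₂`, `{y₂ = y₄ = y₆ = 0} ↦ {y₁ = y₄ = y₆ = 0}`;
an isometry of determinant `-1` swaps the two families of planes of an even-dimensional quadric), and
`H⁴(Q(ℂ); ℂ) = ℂ[Λ] ⊕ ℂ[Λ']`; hence the `A_{B₀}`-invariants of `H⁴(Q(ℂ); ℂ)` are the line `ℂ h²`.
On the other side `Λ_{B₀} = {2·𝟙_S : |S| even} ⊂ (ℤ/4)⁶` contains exactly one admissible character,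
`(2,2,2,2,2,2)`, which is a Hodge character, so `𝔇₀` IS PURE and `m(𝔇₀) = invariantRank 𝔇₀ = 2`
(all proved below, sorry-free). The crux at `(𝔇₀, c₀)` would give `e₁, e₂` in the invariant line with
`2 ≤ cupRank (span {e₁, e₂}) ≤ dim span {e₁, e₂} ≤ 1` (take `x := e`) — a contradiction.

This file lands the kernel-checked hook
`InvariantClassesAreHodge_false_of_quadricMemberInvariantLine :
QuadricMemberInvariantLine → ¬ InvariantClassesAreHodge`, where the hypothesis
`QuadricMemberInvariantLine` (smoothness of the reduced member `X_{c₀}` and `dim range π ≤ 1`, i.e. the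
cohomology `H⁴` of the quadric fourfold with its `A_{B₀}`-action, rendered in the tree's
`complexBetti` / `eigenProjector`) is classical but not constructible in the tree today. The same
mechanism kills the registered stub `stub_invariantRationalBasis` (`dim range π = invariantRank` fails at
`(𝔇₀, c₀)`), and a second witness family is `(2, 6, {3eᵢ + 3eⱼ})`, `c ≡ 2`, `form = (Σ xᵢ³)²`, the
Fermat cubic fourfold with `A_B ⊇ μ₃⁶` (invariants `ℂ h²` by Shioda, `invariantRank = 2`).
CLASS: misstated — REPAIR: add `SmoothHypersurface.IsNonsingularForm ℂ (𝔇.form c)` (the degree-`d` form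
itself nonsingular, i.e. `c` in the connected smooth locus of the family) to the crux, to stubs 1–2, and
to the conclusion of `TropicalShadowsCarryRank` (whose `∃ c` feeds the crux in `closes`); the witness
misses the repaired statements (`(Σ xᵢ²)²` is a singular form).
Refuter seat refuter-skel-stmt-HodgeConjecture-18620-vet-0 (skeleton vet at birth), 2026-08-17.
-/

noncomputable section

-- The mandated namespace `Summit.<P>.<Sub>.Theorems.…` repeats `HodgeConjecture` (single-conjunct summit).
set_option linter.dupNamespace false

namespace Summit.HodgeConjecture.HodgeConjecture.Theorems.InvariantClassesAreHodge.Negative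

open Literature.AlgebraicGeometry.HodgeTheory Literature.AlgebraicGeometry.Motives
open Summit.HodgeConjecture.HodgeConjecture.Theses.SparseFermatTropicalDeficiency
  (InvariantClassesAreHodge)

/-! ### The datum `𝔇₀ = (2, 4, {2eᵢ + 2eⱼ})` and the member `c₀ ≡ 2` -/

/-- The exponent vector `2eᵢ + 2eⱼ` of the monomial `xᵢ²xⱼ²`. [folklore] -/
def pairExp (ij : Fin (2 * 2 + 2) × Fin (2 * 2 + 2)) : Fin (2 * 2 + 2) →₀ ℕ :=
  Finsupp.single ij.1 2 + Finsupp.single ij.2 2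

/-- `B₀ = {2eᵢ + 2eⱼ : i < j}` — the fifteen mixed monomials `xᵢ²xⱼ²` of `(Σ xᵢ²)²`. [folklore] -/
def quarticPairs : Finset (Fin (2 * 2 + 2) →₀ ℕ) :=
  ((Finset.univ : Finset (Fin (2 * 2 + 2) × Fin (2 * 2 + 2))).filter fun ij ↦ ij.1 < ij.2).image
    pairExp

/-- Elements of `B₀` are `2eᵢ + 2eⱼ` with `i < j`. [folklore] -/
theorem exists_of_mem_quarticPairs {b : Fin (2 * 2 + 2) →₀ ℕ} (hb : b ∈ quarticPairs) :
    ∃ i j : Fin (2 * 2 + 2), i < j ∧ b = Finsupp.single i 2 + Finsupp.single j 2 := by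
  obtain ⟨⟨i, j⟩, hij, rfl⟩ := Finset.mem_image.mp hb
  exact ⟨i, j, (Finset.mem_filter.mp hij).2, rfl⟩

/-- `2eᵢ + 2eⱼ ∈ B₀` for `i < j`. [folklore] -/
theorem pairExp_mem_quarticPairs {i j : Fin (2 * 2 + 2)} (h : i < j) :
    pairExp (i, j) ∈ quarticPairs :=
  Finset.mem_image.mpr ⟨(i, j), Finset.mem_filter.mpr ⟨Finset.mem_univ _, h⟩, rfl⟩

/-- **The witness datum `𝔇₀ = (p, d, B) = (2, 4, {2eᵢ + 2eⱼ : i < j})`**: quartic fourfolds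
`Σ xᵢ⁴ + Σ_{i<j} c_{ij} xᵢ²xⱼ² = 0` in `ℙ⁵`, whose member `c ≡ 2` is the double quadric `(Σ xᵢ²)² = 0`.
(An `abbrev`, so that `quadricDatum.p = 2`, `quadricDatum.d = 4` unfold reducibly in binder types.)
[folklore] -/
abbrev quadricDatum : SparseFermat.Datum where
  p := 2
  d := 4
  B := quarticPairs
  two_le_p := le_rfl
  three_le_d := by norm_num
  degree_eq b hb := by
    obtain ⟨i, j, -, rfl⟩ := exists_of_mem_quarticPairs hb
    simp [Finset.sum_add_distrib, Finsupp.single_apply]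
  two_le_card_support b hb := by
    obtain ⟨i, j, hij, rfl⟩ := exists_of_mem_quarticPairs hb
    have hne : i ≠ j := hij.ne
    exact Finset.one_lt_card.mpr
      ⟨i, by simp [hne], j, by simp [hne.symm], hne⟩

/-- **The degenerate member `c₀ ≡ 2`**: `form 𝔇₀ c₀ = Σ xᵢ⁴ + 2 Σ_{i<j} xᵢ²xⱼ² = (Σ xᵢ²)²`, whose
REDUCED zero scheme `𝔇₀.variety c₀` is the smooth quadric fourfold `Q ⊂ ℙ⁵`. [folklore] -/
def cTwo : ↥quadricDatum.B → ℂ := fun _ ↦ 2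

/-! ### Purity of `𝔇₀` and `invariantRank 𝔇₀ = 2` (sorry-free) -/

/-- The character `(2,2,2,2,2,2) ∈ (ℤ/4)⁶`. [folklore] -/
def allTwo : Fin (2 * quadricDatum.p + 2) → ZMod quadricDatum.d := fun _ ↦ 2

/-- `2 ≠ 0` in `ℤ/4`. [folklore] -/
theorem two_ne_zero' : (2 : ZMod quadricDatum.d) ≠ 0 := by decide

/-- units of `ℤ/4` fix `2`: `t · 2 = 2`. [folklore] -/
theorem mul_two_eq_two_of_mul_eq_one :
    ∀ u v : ZMod quadricDatum.d, u * v = 1 → u * 2 = 2 := by decide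

/-- `(2,…,2)` is admissible: all components non-zero, sum `12 = 0`. [folklore] -/
theorem allTwo_isAdmissible : FermatCharacter.IsAdmissible allTwo := by
  refine ⟨fun _ ↦ two_ne_zero', ?_⟩
  show ∑ _i : Fin (2 * quadricDatum.p + 2), (2 : ZMod quadricDatum.d) = 0
  decide

/-- `(2,…,2)` is a Hodge character: `t · (2,…,2) = (2,…,2)` for both units `t = ±1` of `ℤ/4`, and
`2 · Σ ⟨2⟩ = 2 · 12 = 24 = 4 · 6`. [cite: Shioda1979PJA, §1 eq. (2) and §4] -/
theorem allTwo_isHodge : FermatCharacter.IsHodge allTwo := by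
  refine ⟨allTwo_isAdmissible, fun t ↦ ?_⟩
  have ht : ∀ i, (t : ZMod quadricDatum.d) * allTwo i = 2 := fun _ ↦
    mul_two_eq_two_of_mul_eq_one _ _ t.mul_inv
  simp_rw [ht]
  show 2 * ∑ _i : Fin (2 * quadricDatum.p + 2), (2 : ZMod quadricDatum.d).val =
    quadricDatum.d * (2 * quadricDatum.p + 2)
  decide

/-- Every element of `Λ_{B₀} = ⟨2eᵢ + 2eⱼ⟩ ⊂ (ℤ/4)⁶` has all its components in `{0, 2}`.
[folklore] -/
theorem apply_eq_zero_or_two_of_mem_charLattice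
    {α : Fin (2 * quadricDatum.p + 2) → ZMod quadricDatum.d} (hα : α ∈ quadricDatum.charLattice)
    (i : Fin (2 * quadricDatum.p + 2)) : α i = 0 ∨ α i = 2 := by
  revert i
  refine AddSubgroup.closure_induction (p := fun x _ ↦ ∀ i, x i = 0 ∨ x i = 2)
    (fun x hx ↦ ?_) ?_ (fun x y _ _ hx hy ↦ ?_) (fun x _ hx ↦ ?_) hα
  · obtain ⟨b, rfl⟩ := hx
    obtain ⟨a, a', -, hb⟩ := exists_of_mem_quarticPairs b.2
    intro i
    simp only [hb, Finsupp.coe_add, Pi.add_apply, Finsupp.single_apply]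
    split_ifs <;> decide
  · intro i
    exact Or.inl rfl
  · intro i
    show x i + y i = 0 ∨ x i + y i = 2
    rcases hx i with h | h <;> rcases hy i with h' | h' <;> rw [h, h'] <;> decide
  · intro i
    show -x i = 0 ∨ -x i = 2
    rcases hx i with h | h <;> rw [h] <;> decide

/-- **`𝔇₀` is pure**: the only admissible character of `Λ_{B₀}` is `(2,…,2)`, a Hodge character.
[cite: Shioda1979PJA, §1 eq. (2) and §4] -/
theorem quadricDatum_isPure : quadricDatum.IsPure := by
  intro α hadm hmem
  obtain rfl : α = allTwo := funext fun i ↦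
    ((apply_eq_zero_or_two_of_mem_charLattice hmem i).resolve_left (hadm.1 i))
  exact allTwo_isHodge

/-- A generator `2eᵢ + 2eⱼ` of `Λ_{B₀}`, read in `(ℤ/4)⁶`, is `k ↦ [i = k]·2 + [j = k]·2`. [folklore] -/
theorem generator_eq (i j : Fin (2 * quadricDatum.p + 2)) :
    (fun k ↦ (((pairExp (i, j) : Fin (2 * quadricDatum.p + 2) →₀ ℕ) k : ℕ) : ZMod quadricDatum.d)) =
      fun k ↦ (if i = k then (2 : ZMod quadricDatum.d) else 0) + (if j = k then 2 else 0) := by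
  funext k
  simp only [pairExp, Finsupp.coe_add, Pi.add_apply, Finsupp.single_apply]
  split_ifs <;> decide

/-- `2eᵢ + 2eⱼ ∈ Λ_{B₀}` (as the function `k ↦ [i = k]·2 + [j = k]·2`) for `i < j`. [folklore] -/
theorem generator_mem_charLattice {i j : Fin (2 * quadricDatum.p + 2)} (h : i < j) :
    (fun k ↦ (if i = k then (2 : ZMod quadricDatum.d) else 0) + (if j = k then 2 else 0)) ∈
      quadricDatum.charLattice := by
  rw [← generator_eq]
  exact AddSubgroup.subset_closure ⟨⟨pairExp (i, j), pairExp_mem_quarticPairs h⟩, rfl⟩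

/-- `(2,…,2) = (2e₀ + 2e₁) + (2e₂ + 2e₃) + (2e₄ + 2e₅) ∈ Λ_{B₀}`. [folklore] -/
theorem allTwo_mem_charLattice : allTwo ∈ quadricDatum.charLattice := by
  have hsum := add_mem (add_mem (generator_mem_charLattice (i := 0) (j := 1) (by decide))
    (generator_mem_charLattice (i := 2) (j := 3) (by decide)))
    (generator_mem_charLattice (i := 4) (j := 5) (by decide))
  convert hsum using 1
  decide

/-- **`invariantRank 𝔇₀ ≥ 2`** (in fact `= 2`): `h²` and the admissible invariant character
`(2,…,2)`. [cite: Shioda1979PJA, §4] -/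
theorem two_le_invariantRank : 2 ≤ quadricDatum.invariantRank := by
  unfold SparseFermat.Datum.invariantRank
  haveI : Nonempty {α : Fin (2 * quadricDatum.p + 2) → ZMod quadricDatum.d //
      FermatCharacter.IsAdmissible α ∧ α ∈ quadricDatum.charLattice} :=
    ⟨⟨allTwo, allTwo_isAdmissible, allTwo_mem_charLattice⟩⟩
  have : 0 < Nat.card {α : Fin (2 * quadricDatum.p + 2) → ZMod quadricDatum.d //
      FermatCharacter.IsAdmissible α ∧ α ∈ quadricDatum.charLattice} := Nat.card_pos
  omega

/-! ### The hypothesis `H` and the negative lemma -/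

/-- **Hypothesis `H` of the negative lemma (classical, NOT constructible in the tree today): the
degenerate member `X_{c₀} = 𝔇₀.variety c₀ = V₊((Σ xᵢ²)²)_red`, i.e. the smooth quadric fourfold
`Q ⊂ ℙ⁵_ℂ`, is smooth projective of dimension `4`, and the `A_{B₀}`-invariant part
`range (𝔇₀.proj c₀)` of `H⁴(Q(ℂ); ℂ)` has dimension `≤ 1`.** Why true: `H⁴(Q(ℂ); ℂ) = ℂ[Λ] ⊕ ℂ[Λ']`
(the two rulings; `Q(ℂ) ≅ Gr(2, ℂ⁴)`), and the symmetry `(-1,1,1,1,1,1) ∈ A_{B₀}` is an isometry of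
`Σ xᵢ²` of determinant `-1`, hence interchanges the two families of planes, so the invariants are
`ℂ([Λ] + [Λ']) = ℂ h²`. Discharging it in the tree needs the cohomology of the quadric (or of the
degree-2 Fermat fourfold: `A_{B₀} ⊇ μ₂⁶`, invariants `= fermatEigenspace 0 = ℂ h²`) for the REDUCED
scheme `hypersurface ((Σ xᵢ²)²) = hypersurface (Σ xᵢ²)`. (`Q ≅ 𝔾(1,3)` by Plücker, and
`A²(𝔾(1,3)) = ℤσ₂ ⊕ ℤσ_{1,1}`, `σ₁² = σ₂ + σ_{1,1}`: Eisenbud–Harris Thm. 3.10 / Cor. 3.12; the class of the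
variety of isotropic planes: Prop. 4.15 — reference `EisenbudHarris2016`, *3264 and All That*.) HYPOTHESIS of
this negative lemma (filed `--negative-modulo QuadricMemberInvariantLine`); classical, but deliberately NOT a
cited Literature fact of the tree (it mentions the local witnesses `quadricDatum`, `cTwo`). -/
def QuadricMemberInvariantLine : Prop :=
  IsSmoothProjective (2 * quadricDatum.p) (quadricDatum.variety cTwo) ∧
    Module.finrank ℂ ↥(LinearMap.range (quadricDatum.proj cTwo)) ≤ 1

/-- **Negative lemma: `QuadricMemberInvariantLine → ¬ InvariantClassesAreHodge`.** At the pure datum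
`𝔇₀` and the degenerate smooth member `c₀ ≡ 2` the crux yields `e : Fin m → H⁴`, `m = invariantRank 𝔇₀
≥ 2`, with every `e i` fixed by `π = 𝔇₀.proj c₀`; taking the family `x := e` itself, the span of the
`π (e a) = e a` lies in `range π`, of dimension `≤ 1` by `H`, so
`2 ≤ m ≤ cupRank (span e) ≤ finrank (span e) ≤ 1`. [cite: Shioda1979PJA, §4] -/
theorem InvariantClassesAreHodge_false_of_quadricMemberInvariantLine
    (H : QuadricMemberInvariantLine) : ¬ InvariantClassesAreHodge := by
  intro hcrux
  obtain ⟨hX, hrank⟩ := H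
  obtain ⟨e, he, hcup⟩ := hcrux quadricDatum quadricDatum_isPure cTwo hX
  haveI := finite_complexBetti_of_isSmoothProjective hX (2 * quadricDatum.p)
  have hfix : ∀ i, quadricDatum.proj cTwo (e i) = e i := fun i ↦ (he i).2.2
  -- the family `x := e`: its invariant projections are the `e i` themselves
  have hmem : ∀ i, e i ∈ Submodule.span ℂ (Set.range fun a ↦ quadricDatum.proj cTwo (e a)) :=
    fun i ↦ Submodule.subset_span ⟨i, hfix i⟩
  have hm := hcup (Fin quadricDatum.invariantRank) e hmem
  have hle : Submodule.span ℂ (Set.range fun a ↦ quadricDatum.proj cTwo (e a)) ≤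
      LinearMap.range (quadricDatum.proj cTwo) :=
    Submodule.span_le.mpr (by rintro _ ⟨a, rfl⟩; exact LinearMap.mem_range_self _ _)
  have hW : Module.finrank ℂ
      ↥(Submodule.span ℂ (Set.range fun a ↦ quadricDatum.proj cTwo (e a))) ≤ 1 :=
    (Submodule.finrank_mono hle).trans hrank
  have hcr : cupRank (quadricDatum.variety cTwo) (2 * quadricDatum.p)
      (Submodule.span ℂ (Set.range fun a ↦ quadricDatum.proj cTwo (e a))) ≤ 1 :=
    (LinearMap.finrank_range_le _).trans hW
  have h2 := two_le_invariantRank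
  omega

end Summit.HodgeConjecture.HodgeConjecture.Theorems.InvariantClassesAreHodge.Negative

end
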